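import Mathlib
import Literature.NumberTheory.LFunctions.KlurmanMangerelTeravainenShortAPs
import Summits.QuantumAdvantage.QuantumAdvantage.Theorems.MobiusLadderDigitPolyUniformityKMTOddBlocks
import Summits.QuantumAdvantage.QuantumAdvantage.Theorems.MobiusLadderDigitPolyUniformityKMTRegroup
import Summits.QuantumAdvantage.QuantumAdvantage.Theorems.MobiusLadderDigitPolyUniformityKMTValuationSplit
import Summits.QuantumAdvantage.QuantumAdvantage.Theorems.MobiusLadderDigitPolyUniformityKMTAlignedBlocksReal
import Summits.QuantumAdvantage.QuantumAdvantage.Theorems.MobiusLadderDigitPolyUniformityMRTClasses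
import Summits.QuantumAdvantage.QuantumAdvantage.Theorems.MobiusLadderDigitPolyUniformityRigidityGlue
import HarnessLib

/-!
# Crux `DigitPolyUniformity` (stmt-QuantumAdvantage-1392), line `Sketch` — cycle 7 (seat c6):
# the KLURMAN–MANGEREL–TERÄVÄINEN CLASS — λ is orthogonal to every WINDOW-FREE two-ends function

Registered lead stubs `liouville_windowFree_weight_le`, `digitPolyUniformity_windowFree`,
`inapprox_range_of_rigidity_natural`, `liouvilleNotAC0Xor_of_rigidity_natural` of the cycle-7 section of
`Cruxes/DigitPolyUniformity/Lines/SketchLAR.lean`.  CONDITIONAL on the named fact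
`Literature.NumberTheory.LFunctions.KMT2023_corollary17_liouville_twoPower` (Klurman–Mangerel–Teräväinen 2023,
Corollary 1.7 / Theorem 1.6 for `f = λ`, `q = 2^k`), taken as the hypothesis `hKMT`; everything else is proved:

* `liouville_windowFree_weight_le` — for every `ε > 0` there are `c > 0`, `w₀` with, eventually in `n`, for all
  `k ≤ c√n` and `h` with `k + w₀ ≤ h ≤ n − w₀` and every 1-bounded `g`: `|Σ_{N<2ⁿ} λ(N) g(N mod 2^k, ⌊N/2^h⌋)| ≤ ε2ⁿ`.
  Regroup into block/residue sums (`stub_kmt_regroup`), split the residues by 2-adic valuation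
  (`stub_kmt_valuation_split`), bound the odd classes at the moduli `2^{k−j}` by `liouville_oddAP_blocks_le` (KMT)
  and the class of `0` by the PROVED Matomäki–Radziwiłł–Tao aligned blocks (`stub_kmt_alignedBlocks_real`).
* `digitPolyUniformity_windowFree` — the crux for every `P` whose variables avoid a window `[k, h)` of digit
  positions, `k ≤ c√n`, `k + w₀ ≤ h ≤ n − w₀` (via `stub_eval_eq_of_vars_ends`); contains line 0's `stub_ends` class
  (`(k+m)^3 ≤ n`) and seat c5's two-ends classes (`k = C` fixed) and is the first class with super-polylogarithmic
  BOTTOM depth at EVERY top depth — exactly what the 2-adic × Benford chirp products of cycle 6 require.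
* `inapprox_range_of_rigidity_natural`, `liouvilleNotAC0Xor_of_rigidity_natural` — W and `L_λ ∉ AC0Mod 2` from the
  NATURAL rigidity hypothesis Rigidity♮ (tests = window-free two-ends functions; λ-free; a CONJECTURE of this line,
  never asserted), exactly as `inapprox_range_of_rigidity`.
-/

noncomputable section

namespace Summit.QuantumAdvantage.DigitPolyUniformity.SketchLAR

open Filter Finset
open Literature.NumberTheory.LFunctions

namespace KMT

/-- Inheritance of the admissibility condition under the valuation split: if `L k² + L + k ≤ n` and `j ≤ k` then
`L (k−j)² + L ≤ n − j`. [folklore] -/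
theorem admissible_sub (L k j n : ℕ) (hj : j ≤ k) (h : L * k ^ 2 + L + k ≤ n) :
    L * (k - j) ^ 2 + L ≤ n - j := by
  have h1 : L * (k - j) ^ 2 ≤ L * k ^ 2 :=
    Nat.mul_le_mul_left L (Nat.pow_le_pow_left (Nat.sub_le k j) 2)
  omega

/-- `Σ_{j<k} 2^{n−j} ≤ 2·2ⁿ` for `k ≤ n` (as reals). [folklore] -/
theorem sum_two_pow_sub_le (n k : ℕ) (hk : k ≤ n) : ∑ j ∈ range k, (2 : ℝ) ^ (n - j) ≤ 2 * 2 ^ n := by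
  have hterm : ∀ j ∈ range k, (2 : ℝ) ^ (n - j) = 2 ^ n * (1 / 2) ^ j := by
    intro j hj
    rw [Finset.mem_range] at hj
    rw [one_div, inv_pow, ← div_eq_mul_inv, eq_div_iff (by positivity), ← pow_add,
      Nat.sub_add_cancel (by omega)]
  rw [Finset.sum_congr rfl hterm, ← Finset.mul_sum]
  have hgeom : ∑ j ∈ range k, (1 / 2 : ℝ) ^ j ≤ 2 := by
    rw [geom_sum_eq (by norm_num) k]
    have h1 : (0 : ℝ) ≤ (1 / 2) ^ k := by positivity
    have : ((1 / 2 : ℝ) ^ k - 1) / (1 / 2 - 1) = 2 * (1 - (1 / 2) ^ k) := by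
      field_simp; ring
    rw [this]; linarith
  have h2n : (0 : ℝ) ≤ 2 ^ n := by positivity
  nlinarith

/-- **The Klurman–Mangerel–Teräväinen class (lead; CONDITIONAL on the KMT named fact).** For every `ε > 0` there
are `c > 0` and `w₀` such that, eventually in `n`, for all `k ≤ c√n`, all `h` with `k + w₀ ≤ h ≤ n − w₀` and every
1-bounded `g`: `|Σ_{N<2ⁿ} λ(N) g(N mod 2^k, ⌊N/2^h⌋)| ≤ ε2ⁿ`.
[cite: KlurmanMangerelTeravainen2023ShortAPs, Corollary 1.7 and Theorem 1.6] [cite: MatomakiRadziwillTao2015, Theorem 1.3] -/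
theorem liouville_windowFree_weight_le (hKMT : KMT2023_corollary17_liouville_twoPower) :
    ∀ ε : ℝ, 0 < ε → ∃ c : ℝ, 0 < c ∧ ∃ w₀ : ℕ, ∀ᶠ n : ℕ in atTop, ∀ k h : ℕ,
      (k : ℝ) ≤ c * Real.sqrt n → k + w₀ ≤ h → h + w₀ ≤ n →
      ∀ g : ℕ → ℕ → ℝ, (∀ a b, |g a b| ≤ 1) →
        |∑ N ∈ range (2 ^ n), ((ArithmeticFunction.liouville N : ℤ) : ℝ) * g (N % 2 ^ k) (N / 2 ^ h)| ≤
          ε * 2 ^ n := by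
  intro ε hε
  obtain ⟨L, hL⟩ := liouville_oddAP_blocks_le hKMT (ε / 4) (by positivity)
  obtain ⟨h₀, hB⟩ := stub_kmt_alignedBlocks_real (ε / 4) (by positivity)
  obtain ⟨N₀, hN₀⟩ := Filter.eventually_atTop.1 hB
  have hc : (0 : ℝ) < 1 / (2 * ((L : ℝ) + 1)) := by positivity
  refine ⟨1 / (2 * ((L : ℝ) + 1)), hc, L + h₀ + 1, ?_⟩
  filter_upwards [eventually_ge_atTop (4 * L + 2 * N₀ + 4)] with n hn k h hkc hkh hhn g hg
  -- size of `k`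
  have hnR : (4 : ℝ) ≤ n := by exact_mod_cast (show 4 ≤ n by omega)
  have hsqrt_le : Real.sqrt n ≤ (n : ℝ) / 2 := by
    rw [Real.sqrt_le_iff]; constructor
    · positivity
    · nlinarith
  have hkR : (k : ℝ) ≤ (n : ℝ) / 4 := by
    have hc2 : 1 / (2 * ((L : ℝ) + 1)) ≤ 1 / 2 :=
      one_div_le_one_div_of_le (by norm_num) (by nlinarith [(Nat.cast_nonneg L : (0 : ℝ) ≤ L)])
    calc (k : ℝ) ≤ 1 / (2 * ((L : ℝ) + 1)) * Real.sqrt n := hkc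
      _ ≤ 1 / 2 * ((n : ℝ) / 2) := by gcongr
      _ = n / 4 := by ring
  have hk4 : 4 * k ≤ n := by
    have : (4 * k : ℝ) ≤ n := by linarith
    exact_mod_cast this
  have hLk4 : 4 * (L * k ^ 2) ≤ n := by
    have hk2 : (k : ℝ) ^ 2 ≤ (1 / (2 * ((L : ℝ) + 1)) * Real.sqrt n) ^ 2 :=
      pow_le_pow_left₀ (Nat.cast_nonneg k) hkc 2
    rw [mul_pow, Real.sq_sqrt (Nat.cast_nonneg n)] at hk2
    have hLfrac : 4 * (L : ℝ) * (1 / (2 * ((L : ℝ) + 1))) ^ 2 ≤ 1 := by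
      rw [div_pow, one_pow, mul_one_div, div_le_one (by positivity)]
      nlinarith
    have : (4 * (L * k ^ 2) : ℝ) ≤ n := by
      calc (4 * (L * k ^ 2) : ℝ) = 4 * L * (k : ℝ) ^ 2 := by ring
        _ ≤ 4 * L * ((1 / (2 * ((L : ℝ) + 1))) ^ 2 * n) := by gcongr
        _ = (4 * (L : ℝ) * (1 / (2 * ((L : ℝ) + 1))) ^ 2) * n := by ring
        _ ≤ 1 * n := by gcongr
        _ = n := one_mul _
    exact_mod_cast this
  have hadm : L * k ^ 2 + L + k ≤ n := by omega
  -- regroup, then split by valuation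
  have h1 := stub_kmt_regroup (fun N => ((ArithmeticFunction.liouville N : ℤ) : ℝ)) g hg n k h (by omega)
  have h2 := stub_kmt_valuation_split n k h (by omega)
  -- the odd classes at the moduli `2^{k-j}`
  have h3 : ∀ j ∈ range k,
      ∑ y ∈ range (2 ^ ((n - j) - (h - j))), ∑ a ∈ (range (2 ^ (k - j))).filter (fun a => Odd a),
        |∑ N ∈ (Ico (2 ^ (h - j) * y) (2 ^ (h - j) * y + 2 ^ (h - j))).filter (fun N => N % 2 ^ (k - j) = a),
          ((ArithmeticFunction.liouville N : ℤ) : ℝ)| ≤ ε / 4 * 2 ^ (n - j) := by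
    intro j hj
    rw [Finset.mem_range] at hj
    exact hL (n - j) (k - j) (h - j) (by omega) (by omega) (by omega) (admissible_sub L k j n hj.le hadm)
  -- the class of `0`
  have h4 : ∑ y ∈ range (2 ^ ((n - k) - (h - k))),
      |∑ N ∈ Ico (2 ^ (h - k) * y) (2 ^ (h - k) * y + 2 ^ (h - k)), ((ArithmeticFunction.liouville N : ℤ) : ℝ)| ≤
      ε / 4 * 2 ^ (n - k) :=
    hN₀ (n - k) (by omega) (h - k) (by omega) (by omega)
  -- combine
  have h2n : (0 : ℝ) ≤ 2 ^ n := by positivity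
  have hsum : ∑ j ∈ range k, ε / 4 * (2 : ℝ) ^ (n - j) ≤ ε / 2 * 2 ^ n := by
    rw [← Finset.mul_sum]
    have := sum_two_pow_sub_le n k (by omega)
    nlinarith
  have hnk : (2 : ℝ) ^ (n - k) ≤ 2 ^ n := pow_le_pow_right₀ (by norm_num) (Nat.sub_le n k)
  calc |∑ N ∈ range (2 ^ n), ((ArithmeticFunction.liouville N : ℤ) : ℝ) * g (N % 2 ^ k) (N / 2 ^ h)|
      ≤ _ := h1
    _ ≤ _ := h2
    _ ≤ (∑ j ∈ range k, ε / 4 * (2 : ℝ) ^ (n - j)) + ε / 4 * 2 ^ (n - k) :=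
        add_le_add (Finset.sum_le_sum h3) h4
    _ ≤ ε / 2 * 2 ^ n + ε / 4 * 2 ^ n := by gcongr
    _ ≤ ε * 2 ^ n := by nlinarith

/-- **The crux on the window-free class (lead; CONDITIONAL on the KMT named fact).** For every `ε > 0` there are
`c > 0`, `w₀` such that, eventually in `n`, every `P ∈ 𝔽₂[x_0,…,x_{n−1}]` (any degree) whose variables avoid a window
`[k, h)` of digit positions with `k ≤ c√n`, `k + w₀ ≤ h ≤ n − w₀` has `|Σ_{N<2ⁿ} λ(N)(−1)^{P(bits N)}| ≤ ε2ⁿ`.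
[cite: KlurmanMangerelTeravainen2023ShortAPs, Corollary 1.7 and Theorem 1.6] -/
theorem digitPolyUniformity_windowFree (hKMT : KMT2023_corollary17_liouville_twoPower) :
    ∀ ε : ℝ, 0 < ε → ∃ c : ℝ, 0 < c ∧ ∃ w₀ : ℕ, ∀ᶠ n : ℕ in atTop, ∀ P : MvPolynomial (Fin n) (ZMod 2),
      (∃ k h : ℕ, (k : ℝ) ≤ c * Real.sqrt n ∧ k + w₀ ≤ h ∧ h + w₀ ≤ n ∧
        ∀ i ∈ P.vars, (i : ℕ) < k ∨ h ≤ (i : ℕ)) →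
      |∑ N ∈ range (2 ^ n), ((ArithmeticFunction.liouville N : ℤ) : ℝ) *
        (if MvPolynomial.eval (fun i : Fin n => if Nat.testBit N i then (1 : ZMod 2) else 0) P = 1
          then (-1 : ℝ) else 1)| ≤ ε * (2 : ℝ) ^ n := by
  intro ε hε
  obtain ⟨c, hc, w₀, hwf⟩ := liouville_windowFree_weight_le hKMT ε hε
  refine ⟨c, hc, w₀, ?_⟩
  filter_upwards [hwf] with n hn P hP
  obtain ⟨k, h, hkc, hkh, hhn, hvars⟩ := hP
  set s : ℕ → ℝ := fun N =>
    (if MvPolynomial.eval (fun i : Fin n => if Nat.testBit N i then (1 : ZMod 2) else 0) P = 1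
      then (-1 : ℝ) else 1) with hsdef
  have hs1 : ∀ N, |s N| ≤ 1 := fun N => abs_phase_le_one P N
  have hkh' : 2 ^ k ∣ 2 ^ h := pow_dvd_pow 2 (by omega)
  have hloc : ∀ N : ℕ, s N = s (2 ^ h * (N / 2 ^ h) + N % 2 ^ k) := by
    intro N
    have hlow : N % 2 ^ k = (2 ^ h * (N / 2 ^ h) + N % 2 ^ k) % 2 ^ k := by
      obtain ⟨m, hm⟩ := hkh'
      rw [hm, mul_assoc, Nat.mul_add_mod, Nat.mod_mod]
    have hlt : N % 2 ^ k < 2 ^ h :=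
      lt_of_lt_of_le (Nat.mod_lt _ (by positivity)) (Nat.pow_le_pow_right (by norm_num) (by omega))
    have hhigh : N / 2 ^ h = (2 ^ h * (N / 2 ^ h) + N % 2 ^ k) / 2 ^ h := by
      rw [Nat.mul_add_div (by positivity), Nat.div_eq_of_lt hlt, add_zero]
    simp only [hsdef]
    rw [stub_eval_eq_of_vars_ends P k h hvars hlow hhigh]
  set g : ℕ → ℕ → ℝ := fun r y => s (2 ^ h * y + r) with hgdef
  have hg : ∀ r y, |g r y| ≤ 1 := fun r y => hs1 _
  have hmain := hn k h hkc hkh hhn g hg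
  have hrw : ∑ N ∈ range (2 ^ n), ((ArithmeticFunction.liouville N : ℤ) : ℝ) * s N =
      ∑ N ∈ range (2 ^ n), ((ArithmeticFunction.liouville N : ℤ) : ℝ) * g (N % 2 ^ k) (N / 2 ^ h) := by
    refine Finset.sum_congr rfl fun N _ => ?_
    rw [hgdef]; dsimp only
    rw [← hloc N]
  rw [hrw]
  exact hmain

open RigidityGlue in
/-- **W from the NATURAL rigidity hypothesis (lead; CONDITIONAL on the KMT named fact).** Rigidity♮: polylog-degree
digital phases with small ×p-defects for all primes `p ≤ C` correlate with SOME window-free two-ends test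
`g(N mod 2^k, ⌊N/2^h⌋)`, `k ≤ c√n`, `k + w₀ ≤ h ≤ n − w₀`, for the `c, w₀` prescribed by the λ-side (`∀ c > 0, ∀ w₀`).
Then, with `liouville_windowFree_weight_le`, the weak target W follows exactly as in `inapprox_range_of_rigidity`.
Rigidity♮ is a CONJECTURE of this line (λ-free), never asserted; every known near-solution family is an admissible
test. [cite: KlurmanMangerelTeravainen2023ShortAPs, Corollary 1.7 and Theorem 1.6] -/
theorem inapprox_range_of_rigidity_natural (hKMT : KMT2023_corollary17_liouville_twoPower)
    (hR : ∃ C : ℕ, ∃ η ρ : ℝ, 0 < η ∧ 0 < ρ ∧ ∀ A : ℕ, ∀ c : ℝ, 0 < c → ∀ w₀ : ℕ, ∀ᶠ n : ℕ in atTop,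
      ∀ P : MvPolynomial (Fin n) (ZMod 2), P.totalDegree ≤ Nat.log 2 n ^ A →
        (∀ p : ℕ, p.Prime → p ≤ C →
          ((((Ico 1 (2 ^ n / p)).filter fun m =>
              (if MvPolynomial.eval (fun i : Fin n => if Nat.testBit (p * m) i then (1 : ZMod 2) else 0) P = 1
                then (-1 : ℝ) else 1) =
              (if MvPolynomial.eval (fun i : Fin n => if Nat.testBit m i then (1 : ZMod 2) else 0) P = 1
                then (-1 : ℝ) else 1)).card : ℕ) : ℝ) ≤ η * 2 ^ n) →
        ∃ k h : ℕ, (k : ℝ) ≤ c * Real.sqrt n ∧ k + w₀ ≤ h ∧ h + w₀ ≤ n ∧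
          ∃ g : ℕ → ℕ → ℝ, (∀ a b, |g a b| ≤ 1) ∧
          ρ * 2 ^ n ≤ |∑ N ∈ range (2 ^ n),
            (if MvPolynomial.eval (fun i : Fin n => if Nat.testBit N i then (1 : ZMod 2) else 0) P = 1
              then (-1 : ℝ) else 1) * g (N % 2 ^ k) (N / 2 ^ h)|) :
    ∃ c : ℝ, 0 < c ∧ ∀ A : ℕ, ∀ᶠ n : ℕ in atTop, ∀ P : MvPolynomial (Fin n) (ZMod 2),
        P.totalDegree ≤ Nat.log 2 n ^ A →
          ∑ N ∈ Finset.range (2 ^ n), ((ArithmeticFunction.liouville N : ℤ) : ℝ) *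
              (if MvPolynomial.eval (fun i : Fin n => if Nat.testBit N i then (1 : ZMod 2) else 0) P = 1
                then (-1 : ℝ) else 1) ≤ (1 - c) * (2 : ℝ) ^ n := by
  obtain ⟨C, η, ρ, hη, hρ, hR⟩ := hR
  refine ⟨min η (ρ / 4), lt_min hη (by positivity), fun A => ?_⟩
  obtain ⟨c, hc, w₀, hwf⟩ := liouville_windowFree_weight_le hKMT (ρ / 4) (by positivity)
  have hbig : ∀ᶠ n : ℕ in atTop, 2 / ρ ≤ (2 : ℝ) ^ n := by
    refine (Filter.eventually_ge_atTop ⌈2 / ρ⌉₊).mono fun n hn => ?_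
    have h1 : (2 / ρ : ℝ) ≤ n := (Nat.le_ceil _).trans (by exact_mod_cast hn)
    have h2 : (n : ℝ) ≤ (2 : ℝ) ^ n := by exact_mod_cast Nat.lt_two_pow_self.le
    linarith
  filter_upwards [hR A c hc w₀, hwf, hbig] with n hRn hWn hbn P hP
  set φ : ℕ → ℝ := fun N =>
    (if MvPolynomial.eval (fun i : Fin n => if Nat.testBit N i then (1 : ZMod 2) else 0) P = 1
      then (-1 : ℝ) else 1) with hφdef
  set lam : ℕ → ℝ := fun N => ((ArithmeticFunction.liouville N : ℤ) : ℝ) with hlamdef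
  have hφ : ∀ N, φ N = 1 ∨ φ N = -1 := fun N => by
    simp only [hφdef]; split_ifs <;> simp
  have hlam0 : lam 0 = 0 := by simp [hlamdef]
  have hlam : ∀ N ∈ Ico 1 (2 ^ n), lam N = 1 ∨ lam N = -1 := fun N hN =>
    liouville_real_eq_or (by have := (Finset.mem_Ico.1 hN).1; omega)
  have hX : 1 ≤ 2 ^ n := Nat.one_le_two_pow
  show ∑ N ∈ range (2 ^ n), lam N * φ N ≤ (1 - min η (ρ / 4)) * 2 ^ n
  by_contra hcon
  rw [not_le] at hcon
  set E : Finset ℕ := (Ico 1 (2 ^ n)).filter fun N => φ N ≠ lam N with hEdef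
  have hcount := sum_eq_card hX hlam0 hlam hφ
  rw [hcount] at hcon
  have hc1 : min η (ρ / 4) ≤ η := min_le_left _ _
  have hc2 : min η (ρ / 4) ≤ ρ / 4 := min_le_right _ _
  have h2n : (0 : ℝ) < 2 ^ n := by positivity
  have hE : 2 * (E.card : ℝ) < min η (ρ / 4) * 2 ^ n := by
    rw [hEdef]; push_cast at hcon; linarith
  have hdef : ∀ p : ℕ, p.Prime → p ≤ C →
      ((((Ico 1 (2 ^ n / p)).filter fun m => φ (p * m) = φ m).card : ℕ) : ℝ) ≤ η * 2 ^ n := by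
    intro p hp _
    have hle := defect_le (M := 2 ^ n / p) hp.ne_zero φ E (fun m hm hmE hpmE => ?_)
    · have : (((Ico 1 (2 ^ n / p)).filter fun m => φ (p * m) = φ m).card : ℝ) ≤ 2 * E.card := by
        exact_mod_cast hle
      nlinarith
    · have hm1 : 1 ≤ m := (Finset.mem_Ico.1 hm).1
      have hmM : m < 2 ^ n / p := (Finset.mem_Ico.1 hm).2
      have hpm : p * m < 2 ^ n := by
        have := Nat.div_mul_le_self (2 ^ n) p
        have h' : p * m < p * (2 ^ n / p) := Nat.mul_lt_mul_of_pos_left hmM hp.pos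
        rw [mul_comm p (2 ^ n / p)] at h'
        omega
      have hmle : m ≤ p * m := Nat.le_mul_of_pos_left m hp.pos
      have hmI : m ∈ Ico 1 (2 ^ n) := Finset.mem_Ico.2 ⟨hm1, by omega⟩
      have hpmI : p * m ∈ Ico 1 (2 ^ n) := Finset.mem_Ico.2 ⟨by omega, hpm⟩
      have hφm : φ m = lam m := by
        by_contra hne; exact hmE (Finset.mem_filter.2 ⟨hmI, hne⟩)
      have hφpm : φ (p * m) = lam (p * m) := by
        by_contra hne; exact hpmE (Finset.mem_filter.2 ⟨hpmI, hne⟩)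
      have hlampm : lam (p * m) = -lam m := by
        simp only [hlamdef]
        rw [liouville_prime_mul hp (by omega)]
        push_cast; ring
      rw [hφpm, hφm, hlampm]
      rcases hlam m hmI with h | h <;> rw [h] <;> norm_num
  obtain ⟨k, h, hkc, hkh, hhn, g, hg, hcorr⟩ := hRn P hP hdef
  have horth := hWn k h hkc hkh hhn g hg
  have htrans := corr_transfer hX hlam0 hlam hφ (G := fun N => g (N % 2 ^ k) (N / 2 ^ h)) (fun N => hg _ _)
  have hρ2 : ρ * 2 ^ n < ρ / 2 * 2 ^ n + 1 := by
    calc ρ * 2 ^ n ≤ |∑ N ∈ range (2 ^ n), φ N * g (N % 2 ^ k) (N / 2 ^ h)| := hcorr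
      _ ≤ |∑ N ∈ range (2 ^ n), lam N * g (N % 2 ^ k) (N / 2 ^ h)| + 1 + 2 * (E.card : ℝ) := htrans
      _ < ρ / 4 * 2 ^ n + 1 + ρ / 4 * 2 ^ n := by nlinarith [horth]
      _ = ρ / 2 * 2 ^ n + 1 := by ring
  have : ρ / 2 * 2 ^ n < 1 := by linarith
  rw [div_le_iff₀ hρ] at hbn
  nlinarith

/-- **The `AC⁰[⊕]` rung from NATURAL rigidity (lead; CONDITIONAL on the KMT named fact)** — composition with the
landed weak glue (p135858). [cite: Razborov1987] [cite: Smolensky1987] -/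
theorem liouvilleNotAC0Xor_of_rigidity_natural (hKMT : KMT2023_corollary17_liouville_twoPower)
    (hR : ∃ C : ℕ, ∃ η ρ : ℝ, 0 < η ∧ 0 < ρ ∧ ∀ A : ℕ, ∀ c : ℝ, 0 < c → ∀ w₀ : ℕ, ∀ᶠ n : ℕ in atTop,
      ∀ P : MvPolynomial (Fin n) (ZMod 2), P.totalDegree ≤ Nat.log 2 n ^ A →
        (∀ p : ℕ, p.Prime → p ≤ C →
          ((((Ico 1 (2 ^ n / p)).filter fun m =>
              (if MvPolynomial.eval (fun i : Fin n => if Nat.testBit (p * m) i then (1 : ZMod 2) else 0) P = 1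
                then (-1 : ℝ) else 1) =
              (if MvPolynomial.eval (fun i : Fin n => if Nat.testBit m i then (1 : ZMod 2) else 0) P = 1
                then (-1 : ℝ) else 1)).card : ℕ) : ℝ) ≤ η * 2 ^ n) →
        ∃ k h : ℕ, (k : ℝ) ≤ c * Real.sqrt n ∧ k + w₀ ≤ h ∧ h + w₀ ≤ n ∧
          ∃ g : ℕ → ℕ → ℝ, (∀ a b, |g a b| ≤ 1) ∧
          ρ * 2 ^ n ≤ |∑ N ∈ range (2 ^ n),
            (if MvPolynomial.eval (fun i : Fin n => if Nat.testBit N i then (1 : ZMod 2) else 0) P = 1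
              then (-1 : ℝ) else 1) * g (N % 2 ^ k) (N / 2 ^ h)|) :
    Computability.encodingNatBool.toLanguage {N : ℕ | ArithmeticFunction.liouville N = -1} ∉
      Literature.Computability.Complexity.AC0Mod 2 :=
  liouvilleNotAC0Xor_of_inapprox_range (inapprox_range_of_rigidity_natural hKMT hR)

end KMT

end Summit.QuantumAdvantage.DigitPolyUniformity.SketchLAR

end
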